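import Summits.BirchSwinnertonDyer.BirchSwinnertonDyer.Theorems.KimAtThreeDeepLowerOffStratumLevelLoweringMultiStabIhara
import Literature.NumberTheory.EllipticCurves.ModularCurveIharaLemmaDividingPrime
import HarnessLib

/-!
# Route `KimAtThreeKolyvagin` (rung W2), crux `DeepLowerAtThreeOffKatoStratum` (item 19679), registered
# stub `stub_nonAdditive`, ROAD (b^k,add,A): THEOREM D‴ — the NON-DEGENERACY of the `ℓ`-DEPLETED plus symbol of
# `G = Σᵢ cᵢ φᵢ` at a prime `ℓ ∥ level`, from DIAMOND–RIBET'S IHARA LEMMA BY NAME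
# (`diamondRibet1997_iharaLemma_at_dividingPrime_three_additive`)

Cell `bsd-addord`, seat `bsd-addord-w2-acc2`, gen 8; item `stmt-BirchSwinnertonDyer-19679` (`--supports`, closes
nothing). ROAD (b^k,add,A) file 1. On the (A) rows (the Tamagawa `3` AT an additive place `ℓ` of Kodaira type
`IV`/`IV*`) THEOREM A's slot `q` is `ℓ` itself, the comparison form is the `ℓ`-depletion `ι₁ G − a_ℓ(g) ι_ℓ G` of a
form `G` of level `L` with `ℓ ∥ L`, and the non-degeneracy input can no longer come from the `U_ℓ`-relation
(`(a_ℓ − ℓ)·φ̄ = 0` is empty when `a_ℓ ≡ ℓ`) nor from `ribet1984_iharaLemma` (`ℓ ∤ L` there). THIS FILE is gen 6's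
THEOREM D″ (`…MultiStabIhara`) with Ihara's lemma replaced by the NEW named fact
`diamondRibet1997_iharaLemma_at_dividingPrime_three_additive` (Diamond–Ribet 1997 Lemma 4.6, `m_p = 1`): extra inputs
`W₀`, `ℓ ∥ L`, `L > 3ℓ`, `ℓ ≠ 3`, `ℓ² ∣ N_E`, and the congruences `e(r) ≡ a_r(E)` at `r ∤ Lℓ·N_E·3` (they make `ker χ`
belong to `E`). §1 = the dual and cusp-level forms (clones of `Summit.BirchSwinnertonDyer.Rank1Residual.LevelLowering.
exists_{apply_dualMap_sub,sub_mul_apply}_ne_zero_of_ribet1984_iharaLemma`); §2 = THEOREM D‴. Theorems only; no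
definition, no fact, no `sorry`; nothing booked; BSD is not proved by any of this.
References: [DiamondRibet1997] §4.5 Lemma 4.6; [DarmonDiamondTaylor1995] Lemma 4.28 (b), 4.30, §4.5;
[CremonaAlgorithms1997] §2.4; [DiamondShurman2005] Prop. 5.6.2; [Shimura1971] Thm. 3.48.
-/

set_option autoImplicit false
-- the Theorems namespace of a single-conjunct summit repeats the summit name by design (D-0017)
set_option linter.dupNamespace false

noncomputable section

open scoped MatrixGroups ModularForm Classical NNReal
open CongruenceSubgroup WeierstrassCurve Literature.NumberTheory.EllipticCurves
  Literature.NumberTheory.EllipticCurves.ModularForms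
open UpperHalfPlane hiding I

namespace Summit.BirchSwinnertonDyer.BirchSwinnertonDyer.Theorems.KimAtThreeDeepLowerOffStratumLevelLoweringDepleteIhara

open Summit.BirchSwinnertonDyer.BirchSwinnertonDyer.Theorems.KimAtThreeDeepLowerOffStratumLevelLoweringVatsal
open Summit.BirchSwinnertonDyer.BirchSwinnertonDyer.Theorems.KimAtThreeDeepLowerOffStratumLevelLoweringVatsalStabRows
open Summit.BirchSwinnertonDyer.BirchSwinnertonDyer.Theorems.KimAtThreeDeepLowerOffStratumLevelLoweringVatsalIhara
open Summit.BirchSwinnertonDyer.BirchSwinnertonDyer.Theorems.KimAtThreeDeepLowerOffStratumLevelLoweringMultiStabPeriod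
open Summit.BirchSwinnertonDyer.BirchSwinnertonDyer.Theorems.KimAtThreeDeepLowerOffStratumLevelLoweringMultiStabIhara
  (exists_eigenvalue_primeTo_family)
open Summit.BirchSwinnertonDyer.Rank1Residual.LevelLowering

/-! ### §1 Ihara at `ℓ ∥ M` in the dual form, and at the cusps -/

section IharaDual

variable {k : Type*} [CommRing k] {M : ℕ} [NeZero M] {ℓ : ℕ} [Fact ℓ.Prime]

/-- **IHARA AT `ℓ ∥ M`, DUAL (INJECTIVITY) FORM, from `diamondRibet1997_iharaLemma_at_dividingPrime_three_additive`**
(the sibling `LevelLowering.exists_apply_dualMap_sub_ne_zero_of_ribet1984_iharaLemma` with `ℓ ∤ M` replaced by `ℓ ∥ M`,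
`M > 3ℓ`, `ℓ ≠ 3` and `ker χ` of residue characteristic `3` belonging to `W₀`, `E[3]` irreducible, additive at `ℓ`):
for every `w ∈ k` some cycle `z ∈ H₁(X₀(Mℓ), ℤ)` has `Λ(α_* z) − w·Λ(β_* z) ≠ 0`.
[cite: DiamondRibet1997, §4.5 Lemma 4.6] [cite: DarmonDiamondTaylor1995, Lemma 4.28 (b), Lemma 4.30, §4.5 pp. 135–137] -/
theorem exists_apply_dualMap_sub_ne_zero_of_diamondRibet
    (hI : diamondRibet1997_iharaLemma_at_dividingPrime_three_additive)
    (W₀ : WeierstrassCurve ℚ) [W₀.IsElliptic] [W₀.IsGloballyMinimal] (hirr : W₀.HasIrreducibleModPGaloisRep 3)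
    (hℓM : ℓ ∣ M) (hℓ2 : ¬ ℓ ^ 2 ∣ M) (h3ℓ : 3 * ℓ < M) (hℓ3 : ℓ ≠ 3) (hadd : ℓ ^ 2 ∣ W₀.conductorNorm ℤ)
    (Λ : Module.Dual ℂ (CuspForm (Gamma0 M) 2) → k)
    (χ : HeckeRing0.primeTo M 2 (M * ℓ) →+* k)
    (hΛ : ∀ (s : HeckeRing0.primeTo M 2 (M * ℓ)), ∀ x ∈ periodHomology M,
      Λ ((s : HeckeRing0 M 2) • x) = χ s * Λ x)
    (h𝔫 : (RingHom.ker χ).IsMaximal) (h3 : (3 : HeckeRing0.primeTo M 2 (M * ℓ)) ∈ RingHom.ker χ)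
    (hE : ¬ HeckeRing0.primeTo.IsEisenstein (RingHom.ker χ))
    (hbel : ∀ (r : ℕ) (hr : r.Prime) (hrS : ¬ r ∣ M * ℓ), ¬ r ∣ W₀.conductorNorm ℤ * 3 →
      HeckeRing0.primeTo.T M 2 (M * ℓ) hr hrS - (W₀.frobeniusTrace r : HeckeRing0.primeTo M 2 (M * ℓ)) ∈
        RingHom.ker χ)
    {x : Module.Dual ℂ (CuspForm (Gamma0 M) 2)} (hx : x ∈ periodHomology M) (hΛx : Λ x ≠ 0)
    (w : k) :
    ∃ z ∈ periodHomology (M * ℓ),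
      Λ ((degeneracyMap0 M (M * ℓ) 1 2).dualMap z) -
        w * Λ ((degeneracyMap0 M (M * ℓ) ℓ 2).dualMap z) ≠ 0 := by
  obtain ⟨s, hs, hsur⟩ := hI W₀ hirr M ℓ hℓM hℓ2 h3ℓ hℓ3 hadd (RingHom.ker χ) h𝔫 h3 hE hbel
  obtain ⟨z, hz, hα, hβ⟩ := hsur x hx 0 (zero_mem _)
  refine ⟨z, hz, ?_⟩
  rw [hα, hβ, smul_zero, apply_zero_eq_zero_of_eigen Λ χ hΛ, mul_zero, sub_zero, hΛ s x hx]
  exact (isUnit_map_of_not_mem_ker χ h𝔫 hs).mul_right_eq_zero.not.mpr hΛx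

/-- **THE `ℓ`-DEPLETED SHAPE DOES NOT VANISH at `ℓ ∥ M` (Diamond–Ribet's Ihara, BY NAME)**: if `μ : ℚ → k` is
CARRIED by `Λ` on closed paths (`μ(r) = Λ(x)` when the cycle `x` is `f ↦ {∞, r}_f`), then `μ(r) − w μ(ℓ r) ≠ 0` for
some `r` (`α_*{∞, γ∞} = {∞, γ∞}`, `β_*{∞, γ∞} = {∞, ℓ·γ∞}`). [cite: DiamondRibet1997, §4.5 Lemma 4.6] [cite: CremonaAlgorithms1997, §2.4] -/
theorem exists_sub_mul_apply_ne_zero_of_diamondRibet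
    (hI : diamondRibet1997_iharaLemma_at_dividingPrime_three_additive)
    (W₀ : WeierstrassCurve ℚ) [W₀.IsElliptic] [W₀.IsGloballyMinimal] (hirr : W₀.HasIrreducibleModPGaloisRep 3)
    (hℓM : ℓ ∣ M) (hℓ2 : ¬ ℓ ^ 2 ∣ M) (h3ℓ : 3 * ℓ < M) (hℓ3 : ℓ ≠ 3) (hadd : ℓ ^ 2 ∣ W₀.conductorNorm ℤ)
    (Λ : Module.Dual ℂ (CuspForm (Gamma0 M) 2) → k)
    (χ : HeckeRing0.primeTo M 2 (M * ℓ) →+* k)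
    (hΛ : ∀ (s : HeckeRing0.primeTo M 2 (M * ℓ)), ∀ x ∈ periodHomology M,
      Λ ((s : HeckeRing0 M 2) • x) = χ s * Λ x)
    (h𝔫 : (RingHom.ker χ).IsMaximal) (h3 : (3 : HeckeRing0.primeTo M 2 (M * ℓ)) ∈ RingHom.ker χ)
    (hE : ¬ HeckeRing0.primeTo.IsEisenstein (RingHom.ker χ))
    (hbel : ∀ (r : ℕ) (hr : r.Prime) (hrS : ¬ r ∣ M * ℓ), ¬ r ∣ W₀.conductorNorm ℤ * 3 →
      HeckeRing0.primeTo.T M 2 (M * ℓ) hr hrS - (W₀.frobeniusTrace r : HeckeRing0.primeTo M 2 (M * ℓ)) ∈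
        RingHom.ker χ)
    {x : Module.Dual ℂ (CuspForm (Gamma0 M) 2)} (hx : x ∈ periodHomology M) (hΛx : Λ x ≠ 0)
    (w : k) {μ : ℚ → k}
    (hμΛ : ∀ y ∈ periodHomology M, ∀ r : ℚ,
      (∀ f : CuspForm (Gamma0 M) 2, y f = modularSymbol f r) → μ r = Λ y) :
    ∃ r : ℚ, μ r - w * μ (ℓ * r) ≠ 0 := by
  obtain ⟨z, hz, hne⟩ := exists_apply_dualMap_sub_ne_zero_of_diamondRibet hI W₀ hirr hℓM hℓ2 h3ℓ hℓ3 hadd Λ χ hΛ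
    h𝔫 h3 hE hbel hx hΛx w
  have hz' : z ∈ (periodHomology (M * ℓ) : Set (Module.Dual ℂ (CuspForm (Gamma0 (M * ℓ)) 2))) := hz
  rw [coe_periodHomology_eq_range] at hz'
  obtain ⟨γ, rfl⟩ := hz'
  have h1 : M * 1 ∣ M * ℓ := by rw [mul_one]; exact dvd_mul_right M ℓ
  have hℓ' : M * ℓ ∣ M * ℓ := dvd_rfl
  by_cases hc : (γ : SL(2, ℤ)) 1 0 = 0
  · exfalso
    apply hne
    rw [periodFunctional_eq_zero_of_apply_eq_zero γ hc, map_zero, map_zero,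
      apply_zero_eq_zero_of_eigen Λ χ hΛ, mul_zero, sub_zero]
  · set r : ℚ := ((γ : SL(2, ℤ)) 0 0 : ℚ) / ((γ : SL(2, ℤ)) 1 0 : ℚ) with hr
    refine ⟨r, ?_⟩
    have hα : μ r = Λ ((degeneracyMap0 M (M * ℓ) 1 2).dualMap (periodFunctional (M * ℓ) γ)) :=
      hμΛ _ (dualMap_degeneracyMap0_mem_periodHomology M (M * ℓ) 1 h1
        (periodFunctional_mem_periodHomology (M * ℓ) γ)) r fun f ↦ by
          rw [dualMap_degeneracyMap0_periodFunctional_apply h1 γ hc f, Nat.cast_one, one_mul]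
    have hβ : μ (ℓ * r) =
        Λ ((degeneracyMap0 M (M * ℓ) ℓ 2).dualMap (periodFunctional (M * ℓ) γ)) :=
      hμΛ _ (dualMap_degeneracyMap0_mem_periodHomology M (M * ℓ) ℓ hℓ'
        (periodFunctional_mem_periodHomology (M * ℓ) γ)) (ℓ * r) fun f ↦ by
          rw [dualMap_degeneracyMap0_periodFunctional_apply hℓ' γ hc f]
    rwa [hα, hβ]

end IharaDual

/-! ### §2 THEOREM D‴: the non-degeneracy for `G = Σ cᵢ φᵢ` at `q ∥ N` -/

section Ihara

variable {N q : ℕ} [NeZero N] {I : Type*} [Fintype I] {φ : I → CuspForm (Gamma0 N) 2} {e : ℕ → ℂ}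

/-- ★ **THEOREM D‴ — the NON-DEGENERACY input of THEOREM A for `G = Σ cᵢ φᵢ` at a prime `q ∥ N`, from
`diamondRibet1997_iharaLemma_at_dividingPrime_three_additive` BY NAME**: THEOREM D″
(`…MultiStabIhara.exists_valuation_stabilisedSymbol_eq_one_sum_smul_of_ribet1984_iharaLemma`) with `q ∤ N` replaced by
`q ∥ N`, `N > 3q`, `q ≠ 3`, a globally minimal `W₀/ℚ` with `E[3]` irreducible and additive at `q` (`q² ∣ N_E`), and the
congruences `e(r) ≡ a_r(E)` at the primes `r ∤ Nq·N_E·3` (so that `ker χ` BELONGS TO `E`); all other hypotheses and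
the conclusion (`(plusSymbol G x₀ − w·plusSymbol G (q x₀))/Ω` is a unit for some `x₀`) verbatim.
[cite: DiamondRibet1997, §4.5 Lemma 4.6] [cite: DarmonDiamondTaylor1995, Lemma 4.28 (b), Lemma 4.30, §4.5 pp. 135–137]
[cite: CremonaAlgorithms1997, §2.4] -/
theorem exists_valuation_stabilisedSymbol_eq_one_sum_smul_of_diamondRibet
    (hI : diamondRibet1997_iharaLemma_at_dividingPrime_three_additive)
    (W₀ : WeierstrassCurve ℚ) [W₀.IsElliptic] [W₀.IsGloballyMinimal] (hirr : W₀.HasIrreducibleModPGaloisRep 3)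
    (hq : q.Prime) (hqN : q ∣ N) (hq2 : ¬ q ^ 2 ∣ N) (h3q : 3 * q < N) (hq3 : q ≠ 3)
    (hadd : q ^ 2 ∣ W₀.conductorNorm ℤ)
    (hφT : ∀ (i : I) (r : ℕ) (hr : r.Prime), ¬ r ∣ N * q →
      (haveI : NeZero r := ⟨hr.ne_zero⟩; heckeT (Gamma0 N) 2 r (φ i)) = e r • φ i)
    (he : ∀ r : ℕ, r.Prime → ¬ r ∣ N * q → IsIntegral ℤ (e r) ∧ (e r).im = 0)
    (hreal : ∀ i n, (cuspCoeff (φ i) n).im = 0) (c : I → ℂ) (ι : PadicAlgCl 3 ≃+* ℂ)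
    (hbel : ∀ r : ℕ, r.Prime → ¬ r ∣ N * q → ¬ r ∣ W₀.conductorNorm ℤ * 3 →
      Valued.v (ι.symm (e r - (W₀.frobeniusTrace r : ℂ))) < 1) {Ω : ℂ}
    (hΩint : ∀ x : ℚ, Valued.v (ι.symm (plusSymbol (∑ i, c i • φ i) x / Ω)) ≤ 1)
    (γ₀ : Gamma0 N) (hγ₀ : (γ₀ : SL(2, ℤ)) 1 0 ≠ 0)
    (hunit : Valued.v (ι.symm (plusSymbol (∑ i, c i • φ i)
      ((((γ₀ : SL(2, ℤ)) 0 0 : ℤ) : ℚ) / (((γ₀ : SL(2, ℤ)) 1 0 : ℤ) : ℚ)) / Ω)) = 1)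
    {r₀ : ℕ} (hr₀ : r₀.Prime) (hr₀S : ¬ r₀ ∣ N * q) (hr₀1 : r₀ ≡ 1 [MOD N * q])
    (hE₀ : Valued.v (ι.symm (e r₀ - (r₀ + 1))) = 1)
    {w : ℂ} (hw : Valued.v (ι.symm (w - 1)) < 1) :
    ∃ x₀ : ℚ, Valued.v (ι.symm ((plusSymbol (∑ i, c i • φ i) x₀ -
      w * plusSymbol (∑ i, c i • φ i) (q * x₀)) / Ω)) = 1 := by
  classical
  haveI : Fact q.Prime := ⟨hq⟩
  haveI := charP_residueField
  set res := IsLocalRing.residue (Valued.integer (PadicAlgCl 3)) with hres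
  set G := ∑ i, c i • φ i with hG
  have hplus : ∀ x : ℚ, plusSymbol G x = ∑ i, c i * (((modularSymbol (φ i) x).re : ℝ) : ℂ) :=
    fun x => plusSymbol_sum_smul_eq_re φ c hreal x
  have hi₀ : ∃ i₀, φ i₀ ≠ 0 := by
    by_contra hall
    push Not at hall
    have h0 : plusSymbol G ((((γ₀ : SL(2, ℤ)) 0 0 : ℤ) : ℚ) / (((γ₀ : SL(2, ℤ)) 1 0 : ℤ) : ℚ)) = 0 := by
      rw [hplus]
      refine Finset.sum_eq_zero fun i _ ↦ ?_
      simp [hall i, modularSymbol]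
    rw [h0, zero_div, map_zero, Valuation.map_zero] at hunit
    exact zero_ne_one hunit
  obtain ⟨i₀, hi₀⟩ := hi₀
  have huniq : ∀ {a b : ℂ}, a • φ i₀ = b • φ i₀ → a = b := fun h => smul_left_injective ℂ hi₀ h
  choose lam hlam using fun s : HeckeRing0.primeTo N 2 (N * q) => exists_eigenvalue_primeTo_family hφT he s
  have hlamA : ∀ s : HeckeRing0.primeTo N 2 (N * q),
      (∀ i, HeckeRing0.toEnd N 2 (s : HeckeRing0 N 2) (φ i) = lam s • φ i) ∧ ‖ι.symm (lam s)‖ ≤ 1 ∧ (lam s).im = 0 :=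
    fun s => ⟨(hlam s).1, norm_le_one_of_isIntegral_int ((hlam s).2.1.map (ι.symm : ℂ →+* PadicAlgCl 3).toIntAlgHom),
      (hlam s).2.2⟩
  let lamHom : HeckeRing0.primeTo N 2 (N * q) →+* ℂ :=
    { toFun := lam
      map_one' := by
        refine huniq ?_
        rw [← (hlamA 1).1 i₀, OneMemClass.coe_one, map_one, Module.End.one_apply, one_smul]
      map_mul' := fun s s' => by
        refine huniq ?_
        rw [← (hlamA (s * s')).1 i₀, Subalgebra.coe_mul, map_mul, Module.End.mul_apply, (hlamA s').1 i₀, map_smul,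
          (hlamA s).1 i₀, smul_smul, mul_comm]
      map_zero' := by
        refine huniq ?_
        rw [← (hlamA 0).1 i₀, ZeroMemClass.coe_zero, map_zero, LinearMap.zero_apply, zero_smul]
      map_add' := fun s s' => by
        refine huniq ?_
        rw [← (hlamA (s + s')).1 i₀, Subalgebra.coe_add, map_add, LinearMap.add_apply, (hlamA s).1 i₀,
          (hlamA s').1 i₀, add_smul] }
  have hlamHom : ∀ s, lamHom s = lam s := fun _ => rfl
  let χ₀ : HeckeRing0.primeTo N 2 (N * q) →+* (Valued.integer (PadicAlgCl 3)) :=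
    ((ι.symm : ℂ →+* PadicAlgCl 3).comp lamHom).codRestrict (Valued.integer (PadicAlgCl 3)) fun s =>
      mem_integer_iff_norm_le_one.mpr (hlamA s).2.1
  have hχ₀ : ∀ s, (χ₀ s : PadicAlgCl 3) = ι.symm (lam s) := fun _ => rfl
  let χ : HeckeRing0.primeTo N 2 (N * q) →+* IsLocalRing.ResidueField (Valued.integer (PadicAlgCl 3)) :=
    res.comp χ₀
  have hχ : ∀ s, χ s = res (χ₀ s) := fun _ => rfl
  have h3ker : (3 : HeckeRing0.primeTo N 2 (N * q)) ∈ RingHom.ker χ := by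
    rw [RingHom.mem_ker, map_ofNat]
    exact CharP.cast_eq_zero _ 3
  haveI hfinT : Module.Finite ℤ (HeckeRing0.primeTo N 2 (N * q)) :=
    Module.Finite.of_injective (HeckeRing0.primeTo N 2 (N * q)).val.toLinearMap Subtype.val_injective
  have h𝔫 : (RingHom.ker χ).IsMaximal := by
    set Q := HeckeRing0.primeTo N 2 (N * q) ⧸ RingHom.ker χ with hQ
    haveI : IsDomain Q := (RingHom.quotientKerEquivRange χ).toMulEquiv.isDomain
    haveI : Module.Finite ℤ Q := Module.Finite.of_surjective
      (Ideal.Quotient.mkₐ ℤ (RingHom.ker χ)).toLinearMap (Ideal.Quotient.mkₐ_surjective ℤ _)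
    haveI : AddGroup.FG Q := Module.Finite.iff_addGroup_fg.mp inferInstance
    have h3Q : (3 : Q) = 0 := by
      have h := Ideal.Quotient.eq_zero_iff_mem.mpr h3ker
      rwa [map_ofNat] at h
    have htors : AddMonoid.IsTorsion Q := by
      intro x
      rw [isOfFinAddOrder_iff_nsmul_eq_zero]
      refine ⟨3, by norm_num, ?_⟩
      rw [nsmul_eq_mul, Nat.cast_ofNat, h3Q, zero_mul]
    haveI : Finite Q := AddCommGroup.finite_of_fg_torsion Q htors
    exact Ideal.Quotient.maximal_of_isField _ (Finite.isField_of_domain Q)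
  have h2 : (2 : IsLocalRing.ResidueField (Valued.integer (PadicAlgCl 3))) ≠ 0 := by
    intro h
    have h3 : (3 : IsLocalRing.ResidueField (Valued.integer (PadicAlgCl 3))) = 0 := by exact_mod_cast CharP.cast_eq_zero _ 3
    have : (1 : IsLocalRing.ResidueField (Valued.integer (PadicAlgCl 3))) = 0 := by
      have e' : (3 : IsLocalRing.ResidueField (Valued.integer (PadicAlgCl 3))) - 2 = 1 := by norm_num
      rw [← e', h, h3, sub_zero]
    exact one_ne_zero this
  have hE : ¬ HeckeRing0.primeTo.IsEisenstein (RingHom.ker χ) := by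
    intro hEis
    have hmem := hEis r₀ hr₀ hr₀S hr₀1
    rw [RingHom.mem_ker, map_sub, hχ] at hmem
    have hT : lam (HeckeRing0.primeTo.T N 2 (N * q) hr₀ hr₀S) = e r₀ := by
      refine huniq ?_
      rw [← (hlamA _).1 i₀]
      show HeckeRing0.toEnd N 2 (HeckeRing0.T N 2 r₀ hr₀) (φ i₀) = e r₀ • φ i₀
      rw [HeckeRing0.toEnd_T]
      exact hφT i₀ r₀ hr₀ hr₀S
    have hval : res (χ₀ (HeckeRing0.primeTo.T N 2 (N * q) hr₀ hr₀S)) -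
        ((r₀ : IsLocalRing.ResidueField (Valued.integer (PadicAlgCl 3))) + 1) = 0 := by
      have : χ ((r₀ : HeckeRing0.primeTo N 2 (N * q)) + 1) =
          (r₀ : IsLocalRing.ResidueField (Valued.integer (PadicAlgCl 3))) + 1 := by
        rw [map_add, map_natCast, map_one]
      rwa [this] at hmem
    have hmemO : ι.symm (e r₀ - (r₀ + 1)) ∈ (Valued.integer (PadicAlgCl 3)) :=
      mem_integer_iff_norm_le_one.mpr (valuation_eq_one_iff.mp hE₀).le
    have hunit' : res ⟨ι.symm (e r₀ - (r₀ + 1)), hmemO⟩ ≠ 0 := by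
      rw [Ne, IsLocalRing.residue_eq_zero_iff, IsLocalRing.mem_maximalIdeal, mem_nonunits_iff, not_not,
        Valuation.Integers.isUnit_iff_valuation_eq_one (Valuation.integer.integers _)]
      exact hE₀
    apply hunit'
    have heq : (⟨ι.symm (e r₀ - (r₀ + 1)), hmemO⟩ : (Valued.integer (PadicAlgCl 3))) =
        χ₀ (HeckeRing0.primeTo.T N 2 (N * q) hr₀ hr₀S) - ((r₀ : (Valued.integer (PadicAlgCl 3))) + 1) := by
      apply Subtype.ext
      push_cast
      rw [hχ₀, hT, map_sub, map_add, map_natCast, map_one]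
    rw [heq, map_sub, map_add, map_natCast, map_one]
    exact hval
  let R : ℂ → IsLocalRing.ResidueField (Valued.integer (PadicAlgCl 3)) := fun z =>
    if h : ‖ι.symm z‖ ≤ 1 then res ⟨ι.symm z, mem_integer_iff_norm_le_one.mpr h⟩ else 0
  have hR : ∀ {z : ℂ} (h : ‖ι.symm z‖ ≤ 1), R z = res ⟨ι.symm z, mem_integer_iff_norm_le_one.mpr h⟩ :=
    fun h => dif_pos h
  let P : Module.Dual ℂ (CuspForm (Gamma0 N) 2) → ℂ := fun y => ∑ i, c i * (((y (φ i)).re : ℝ) : ℂ)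
  let Λ : Module.Dual ℂ (CuspForm (Gamma0 N) 2) → IsLocalRing.ResidueField (Valued.integer (PadicAlgCl 3)) :=
    fun y => R (P y / Ω)
  let μ : ℚ → IsLocalRing.ResidueField (Valued.integer (PadicAlgCl 3)) := fun r => R (plusSymbol G r / Ω)
  have hcycle : ∀ x ∈ periodHomology N, ‖ι.symm (P x / Ω)‖ ≤ 1 := by
    intro x hx
    have hx' : x ∈ (periodHomology N : Set (Module.Dual ℂ (CuspForm (Gamma0 N) 2))) := hx
    rw [coe_periodHomology_eq_range] at hx'
    obtain ⟨γ, rfl⟩ := hx'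
    show ‖ι.symm ((∑ i, c i * ((((periodFunctional N γ (φ i)).re : ℝ) : ℂ))) / Ω)‖ ≤ 1
    simp only [periodFunctional_apply, cuspSymbol]
    split_ifs with hc0
    · simp only [Complex.zero_re, Complex.ofReal_zero, mul_zero, Finset.sum_const_zero, zero_div, map_zero, norm_zero]
      exact zero_le_one
    · rw [← hplus]
      exact valuation_le_one_iff.mp (hΩint _)
  have hΛ : ∀ (s : HeckeRing0.primeTo N 2 (N * q)), ∀ x ∈ periodHomology N,
      Λ ((s : HeckeRing0 N 2) • x) = χ s * Λ x := by
    intro s x hx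
    obtain ⟨hsA, hint, hrl⟩ := hlamA s
    have hsx : ∀ i, ((s : HeckeRing0 N 2) • x) (φ i) = lam s * x (φ i) := by
      intro i
      rw [HeckeRing0.smul_dual_apply, hsA i, map_smul, smul_eq_mul]
    have hreal_lam : ∀ z : ℂ, (((lam s * z).re : ℝ) : ℂ) = lam s * (((z.re : ℝ) : ℂ)) := by
      intro z
      rw [Complex.mul_re, hrl, zero_mul, sub_zero, Complex.ofReal_mul]
      congr 1
      exact Complex.ext (by simp) (by simp [hrl])
    have hre : P ((s : HeckeRing0 N 2) • x) / Ω = lam s * (P x / Ω) := by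
      show (∑ i, c i * (((((s : HeckeRing0 N 2) • x) (φ i)).re : ℝ) : ℂ)) / Ω =
        lam s * ((∑ i, c i * (((x (φ i)).re : ℝ) : ℂ)) / Ω)
      simp only [hsx, hreal_lam]
      rw [mul_div_assoc', Finset.mul_sum]
      congr 1
      refine Finset.sum_congr rfl fun i _ ↦ ?_
      ring
    have h1' : ‖ι.symm (lam s)‖ ≤ 1 := hint
    have h2' := hcycle x hx
    have h12 : ‖ι.symm (lam s * (P x / Ω))‖ ≤ 1 := by
      rw [map_mul, norm_mul]; exact mul_le_one₀ h1' (norm_nonneg _) h2'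
    show R _ = χ s * R _
    rw [hre, hR h12, hR h2', hχ, ← map_mul]
    congr 1
    apply Subtype.ext
    push_cast
    rw [map_mul, hχ₀]
  have hμΛ : ∀ y ∈ periodHomology N, ∀ r : ℚ,
      (∀ f : CuspForm (Gamma0 N) 2, y f = modularSymbol f r) → μ r = Λ y := by
    intro y _ r hy
    show R _ = R ((∑ i, c i * (((y (φ i)).re : ℝ) : ℂ)) / Ω)
    rw [hplus r]
    simp only [hy]
  have hx₀ : periodFunctional N γ₀ ∈ periodHomology N := periodFunctional_mem_periodHomology N γ₀
  have hΛx : Λ (periodFunctional N γ₀) ≠ 0 := by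
    have hPγ : P (periodFunctional N γ₀) / Ω =
        plusSymbol G ((((γ₀ : SL(2, ℤ)) 0 0 : ℤ) : ℚ) / (((γ₀ : SL(2, ℤ)) 1 0 : ℤ) : ℚ)) / Ω := by
      show (∑ i, c i * ((((periodFunctional N γ₀ (φ i)).re : ℝ) : ℂ))) / Ω = _
      simp only [periodFunctional_apply, cuspSymbol, if_neg hγ₀]
      rw [hplus]
    show R _ ≠ 0
    rw [hPγ, hR (valuation_eq_one_iff.mp hunit).le]
    rw [Ne, IsLocalRing.residue_eq_zero_iff, IsLocalRing.mem_maximalIdeal, mem_nonunits_iff, not_not,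
      Valuation.Integers.isUnit_iff_valuation_eq_one (Valuation.integer.integers _)]
    exact hunit
  -- (d') `ker χ` belongs to `E`: `χ(T_r) = a_r(E)` at the primes `r ∤ Nq·N_E·3`
  have hbelE : ∀ (r : ℕ) (hr : r.Prime) (hrS : ¬ r ∣ N * q), ¬ r ∣ W₀.conductorNorm ℤ * 3 →
      HeckeRing0.primeTo.T N 2 (N * q) hr hrS - (W₀.frobeniusTrace r : HeckeRing0.primeTo N 2 (N * q)) ∈
        RingHom.ker χ := by
    intro r hr hrS hrN
    have hT : lam (HeckeRing0.primeTo.T N 2 (N * q) hr hrS) = e r := by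
      refine huniq ?_
      rw [← (hlamA _).1 i₀]
      show HeckeRing0.toEnd N 2 (HeckeRing0.T N 2 r hr) (φ i₀) = e r • φ i₀
      rw [HeckeRing0.toEnd_T]
      exact hφT i₀ r hr hrS
    have hmemO : ι.symm (e r - (W₀.frobeniusTrace r : ℂ)) ∈ (Valued.integer (PadicAlgCl 3)) :=
      mem_integer_iff_norm_le_one.mpr (valuation_lt_one_iff.mp (hbel r hr hrS hrN)).le
    have hzero : res ⟨ι.symm (e r - (W₀.frobeniusTrace r : ℂ)), hmemO⟩ = 0 :=
      residue_mk_eq_zero_of_norm_lt_one _ (valuation_lt_one_iff.mp (hbel r hr hrS hrN))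
    have hzO : ((W₀.frobeniusTrace r : ℤ) : PadicAlgCl 3) ∈ Valued.integer (PadicAlgCl 3) :=
      mem_integer_iff_norm_le_one.mpr (norm_intCast_le_one _)
    have heq : (⟨ι.symm (e r - (W₀.frobeniusTrace r : ℂ)), hmemO⟩ : (Valued.integer (PadicAlgCl 3))) =
        χ₀ (HeckeRing0.primeTo.T N 2 (N * q) hr hrS) - ⟨((W₀.frobeniusTrace r : ℤ) : PadicAlgCl 3), hzO⟩ := by
      apply Subtype.ext
      push_cast
      rw [hχ₀, hT, map_sub, map_intCast]
    rw [RingHom.mem_ker, map_sub, map_intCast, hχ, ← residue_mk_intCast (W₀.frobeniusTrace r) hzO, ← map_sub, ← heq]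
    exact hzero
  obtain ⟨r, hr⟩ := exists_sub_mul_apply_ne_zero_of_diamondRibet hI W₀ hirr hqN hq2 h3q hq3 hadd Λ χ hΛ h𝔫 h3ker
    hE hbelE hx₀ hΛx (1 : IsLocalRing.ResidueField (Valued.integer (PadicAlgCl 3))) hμΛ
  refine ⟨r, ?_⟩
  have hA' := valuation_le_one_iff.mp (hΩint r)
  have hB' := valuation_le_one_iff.mp (hΩint (q * r))
  have hC : ‖ι.symm w‖ ≤ 1 := by
    have : ι.symm w = ι.symm (w - 1) + 1 := by rw [map_sub, map_one, sub_add_cancel]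
    rw [this]
    exact (PadicAlgCl.isNonarchimedean 3 _ _).trans (max_le (valuation_lt_one_iff.mp hw).le (by rw [norm_one]))
  have hc1 : res ⟨ι.symm w, mem_integer_iff_norm_le_one.mpr hC⟩ = 1 := by
    have h := residue_mk_eq_of_norm_sub_lt_one (mem_integer_iff_norm_le_one.mpr hC)
      (one_mem (Valued.integer (PadicAlgCl 3))) (by
      rw [← map_one ι.symm, ← map_sub]; exact valuation_lt_one_iff.mp hw)
    rw [h]; exact map_one res
  have hABC : ‖ι.symm ((plusSymbol G r - w * plusSymbol G (q * r)) / Ω)‖ ≤ 1 := by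
    rw [sub_div, mul_div_assoc, map_sub, map_mul, sub_eq_add_neg]
    refine (PadicAlgCl.isNonarchimedean 3 _ _).trans (max_le hA' ?_)
    rw [norm_neg, norm_mul]; exact mul_le_one₀ hC (norm_nonneg _) hB'
  have hresid : res ⟨ι.symm ((plusSymbol G r - w * plusSymbol G (q * r)) / Ω), mem_integer_iff_norm_le_one.mpr hABC⟩ =
      μ r - 1 * μ (q * r) := by
    show _ = R _ - 1 * R _
    rw [hR hA', hR hB', ← hc1, ← map_mul, ← map_sub]
    congr 1
    apply Subtype.ext
    push_cast
    rw [sub_div, mul_div_assoc, map_sub, map_mul]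
  refine valuation_eq_one_iff.mpr (le_antisymm hABC ?_)
  by_contra hlt
  push Not at hlt
  apply hr
  rw [← hresid]
  exact residue_mk_eq_zero_of_norm_lt_one _ hlt

end Ihara

end Summit.BirchSwinnertonDyer.BirchSwinnertonDyer.Theorems.KimAtThreeDeepLowerOffStratumLevelLoweringDepleteIhara

end
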